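import Summits.BirchSwinnertonDyer.BirchSwinnertonDyer.Theorems.AdditiveKolyvaginRoadAdmissibleHyperbolic
import Summits.BirchSwinnertonDyer.BirchSwinnertonDyer.Theorems.AdditiveKolyvaginRoadTwoPlaceLagrangian
import Summits.BirchSwinnertonDyer.Rank1Residual.X11b.PropagatedUnramified
import Summits.BirchSwinnertonDyer.Rank1Residual.X11b.KummerRelaxedStructures
import Summits.BirchSwinnertonDyer.Rank1Residual.X11b.MaxUnramifiedRestriction
import Literature.NumberTheory.GaloisRepresentations.LocalHOneInertiaRestrictionProfinite
import HarnessLib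

/-!
# Route `AdditiveKolyvaginRoad`, crux `LevelKolyvaginSystemsAdditive` (item stmt-BirchSwinnertonDyer-21396, KS′):
# the LOCAL, WITNESS-FREE form of (Trans) — `H¹_ur(K_v, E[p^k]) ∩ H¹_toric(K_v, E[p^k]) = 0` at every good place
# `v ∤ p` — and, at a Bertolini–Darmon admissible place, `F ≠ O` and the hyperbolic dichotomy WITHOUT a global witness
# (cell `pub/bsd-wall`, width seat `bsd-wall-akr-p2x-w3` g3; `--supports stmt-BirchSwinnertonDyer-21396`, helper)

WHY. akr-p1 g2's `ToricFrob.selmerLocalKer_inf_toricLocalKer_le_torsionLocalKer` is (Trans) for GLOBAL classes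
(`x ∈ H¹(K, E[n])` Kummer and toric at `v` ⟹ `loc_v x = 0`). The hyperbolic dichotomy
`mem_selmerLocalKer_or_mem_toricLocalKer_of_isotropic` (akr-p2x g0, p572961) and with it (R) `selQP_raise_of_admQ` (p577255)
therefore consume a GLOBAL WITNESS `x` — a class Kummer at `w` and not locally trivial at `w` — whose only use is
`F ≠ O` (Kummer line ≠ toric line in `H¹(K_w, E[p])`). At a rank-ZERO level no such witness is at hand for an arbitrary
admissible prime, which blocked the odd→even supply brick of the connectivity of Howard's core graph (width seat w2 g2's
`CoreGraph.connected_of_dichotomy`, hypothesis (Raise); memo `Cruxes/…/SOCKETS-CONGRUENCE.md` §C5). This file removes the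
witness:
* §1 `ToricFrob.closure_restrictField_eq_range` — the augmentation subgroup of `Γ_{K_v}` on `E[n]` IS `(φ − 1)E[n]` for any
  local arithmetic Frobenius lift `φ ∈ Γ_{K_v}` once the inertia group `I_{K_v}` acts trivially (`Γ_{K_v} = closure (I · φ^ℤ)`,
  tree `dense_absInertia_mul_zpowers_of_isFrobPow`); the local twin of `ToricFrob.closure_decomposition_eq_range`.
* §1 `ToricFrob.kummerSelmerStructure_inf_toricLocalCondition_eq_bot` — **LOCAL (Trans)**: for `E/K` over a number field, a
  good place `v ∤ p`: `𝓛_v^{Kummer}(E[p^k]) ⊓ toricLocalCondition = ⊥` in `H¹(K_v, E[p^k])`. Proof: Kummer = unramified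
  (`KummerPT.kummerSelmerStructure_inr_eq_unramifiedSubgroup`), so a toric representative `ψ` (values in the augmentation
  subgroup) vanishes on `I_{K_v}` (`LocBridge.mem_unramifiedSubgroup_one_iff_forall_eq_zero`, inertia trivial on `E[p^k]` by
  `AcSelmer.restrictField_torsionGaloisModule_apply_of_mem_absInertia`); `ψ(φ) = φ m − m` by §1, so `[ψ] = 0` by the tree's
  `oneCocycleClass_eq_zero_iff_of_vanishing_absInertia` (`H¹_ur ≅ T^{I}/(φ − 1)`). Bertolini–Darmon Lemma 2.6, local form.
* §2 at the place `w` of an imaginary quadratic `K` above a BD-admissible `q` for `W/ℚ`: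
  `kummerSelmerStructure_inf_toricLocalCondition_eq_bot_of_admQ`, `kummerSelmerStructure_ne_toricLocalCondition_of_admQ`
  (`F ≠ O`, both of order `p`), and `mem_selmerLocalKer_or_mem_toricLocalKer_of_isotropic_free` = p572961 WITHOUT the
  witness `x` (an isotropic global class is Kummer or toric at `w`).

HONEST FRAMING: theorems only; 0 definitions, 0 named facts, 0 `sorry`; local Galois cohomology of `E[p^k]`; §2's dichotomy
keeps p572961's binders (a Weil pairing, a Poitou–Tate family `inv` with `IsPerfect`); closes nothing. BSD is not proved
by any of this.

References: [cite: BertoliniDarmon2005, §2.2–§2.3, Lemma 2.6] [cite: WZhang2014, §4.1, Lemma 5.1, Lemma 5.3]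
[cite: SerreLocalFields1979, XIII §1 Prop. 1] [cite: Rubin2000, Lemma 1.3.2] [cite: MilneADT2006, Ch. I §2, Prop. 3.8]
[cite: NeukirchSchmidtWingberg2008, Thm. 7.5.3].
-/

-- single-conjunct summit: `Summit.BirchSwinnertonDyer.BirchSwinnertonDyer.…` repeats the name by design
set_option linter.dupNamespace false

noncomputable section

open scoped Classical NumberField Pointwise
open Function NumberField IsDedekindDomain Field WeierstrassCurve
open Literature.NumberTheory.EllipticCurves Literature.NumberTheory.EllipticCurves.ModularForms
open Literature.NumberTheory.GaloisRepresentations Literature.NumberTheory.GaloisRepresentations.DiscreteGaloisModule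
  Literature.NumberTheory.GaloisCohomology
open Literature.NumberTheory.GaloisRepresentations.IsNonarchimedeanLocalField
open Summit.BirchSwinnertonDyer.Rank1Residual.X11b.FiniteDuality
open Summit.BirchSwinnertonDyer.Rank1Residual.X11b.Relaxation
open Summit.BirchSwinnertonDyer.Rank1Residual.X11b
open Summit.BirchSwinnertonDyer.Rank1Residual.GaloisImage
open Summit.BirchSwinnertonDyer.Rank1Residual.X11b.Three.Koly.Method2

namespace Summit.BirchSwinnertonDyer.BirchSwinnertonDyer.Theorems.AdditiveKoly

/-! ## §1 Local (Trans) at every good place `v ∤ p` -/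

namespace ToricFrob

variable {K : Type} [Field K] [NumberField K] (E : WeierstrassCurve K) [E.IsElliptic] {v : HeightOneSpectrum (𝓞 K)}

omit [E.IsElliptic] in
/-- **The augmentation subgroup of `Γ_{K_v}` on `E[n]` is `(φ − 1)E[n]`** for any local arithmetic Frobenius lift
`φ ∈ Γ_{K_v}` (`IsFrobPow φ 1`), as soon as the inertia group `I_{K_v}` acts trivially on `E[n]`: every
`res σ · y − y` lies in `(res φ − 1)E[n]` because `σ ↦ res σ · y − y` is continuous, `I_{K_v} · φ^ℤ` is dense in `Γ_{K_v}`
(`dense_absInertia_mul_zpowers_of_isFrobPow`) and `res(i φʲ) · y − y = res(φ)ʲ y − y = (res φ − 1)(…)`. Local twin of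
`ToricFrob.closure_decomposition_eq_range`. [cite: NeukirchSchmidtWingberg2008, Thm. 7.5.3] [cite: BertoliniDarmon2005, §2.2–§2.3] -/
theorem closure_restrictField_eq_range {n : ℤ} {φ : absoluteGaloisGroup (v.adicCompletion K)} (hφ : IsFrobPow φ 1)
    (hI : ∀ τ ∈ absInertia (v.adicCompletion K), ∀ y : geomTorsion E n,
      absGaloisRestrict K (v.adicCompletion K) τ • y = y) :
    AddSubgroup.closure {m : geomTorsion E n | ∃ (τ : absoluteGaloisGroup (v.adicCompletion K)) (y : geomTorsion E n),
        m = absGaloisRestrict K (v.adicCompletion K) τ • y - y} =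
      (DistribSMul.toAddMonoidHom (geomTorsion E n) (absGaloisRestrict K (v.adicCompletion K) φ) -
        AddMonoidHom.id _).range := by
  set L := v.adicCompletion K with hL
  set g := DistribSMul.toAddMonoidHom (geomTorsion E n) (absGaloisRestrict K L φ) - AddMonoidHom.id _ with hg
  have hgapply : ∀ x, g x = absGaloisRestrict K L φ • x - x := fun x ↦ rfl
  -- every integral power of `res φ` moves `y` inside `range g`
  have hzpow : ∀ (y : geomTorsion E n) (j : ℤ), (absGaloisRestrict K L φ) ^ j • y - y ∈ g.range := by
    intro y j
    induction j using Int.induction_on with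
    | zero => rw [zpow_zero, one_smul, sub_self]; exact zero_mem _
    | succ j ih =>
      have heq : (absGaloisRestrict K L φ) ^ ((j : ℤ) + 1) • y - y =
          g ((absGaloisRestrict K L φ) ^ (j : ℤ) • y) + ((absGaloisRestrict K L φ) ^ (j : ℤ) • y - y) := by
        rw [hgapply, add_comm (j : ℤ) 1, zpow_one_add, mul_smul]
        abel
      rw [heq]
      exact add_mem ⟨_, rfl⟩ ih
    | pred j ih =>
      have hφj : (absGaloisRestrict K L φ) ^ (-(j : ℤ)) =
          absGaloisRestrict K L φ * (absGaloisRestrict K L φ) ^ (-(j : ℤ) - 1) := by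
        rw [← zpow_one_add]; congr 1; ring
      have heq : (absGaloisRestrict K L φ) ^ (-(j : ℤ) - 1) • y - y =
          ((absGaloisRestrict K L φ) ^ (-(j : ℤ)) • y - y) - g ((absGaloisRestrict K L φ) ^ (-(j : ℤ) - 1) • y) := by
        rw [hgapply, hφj, mul_smul]; abel
      rw [heq]
      exact sub_mem ih ⟨_, rfl⟩
  apply le_antisymm
  · rw [AddSubgroup.closure_le]
    rintro m ⟨τ, y, rfl⟩
    -- the set of `σ` moving `y` inside `range g` is closed and contains the dense `I · φ^ℤ`
    have hcont : Continuous fun σ : absoluteGaloisGroup L ↦ absGaloisRestrict K L σ • y - y :=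
      ((GaloisRep.restrictField L (E.torsionGaloisModule n)).continuous_apply_left y).sub continuous_const
    have hclosed : IsClosed {σ : absoluteGaloisGroup L | absGaloisRestrict K L σ • y - y ∈ (g.range : Set (geomTorsion E n))} :=
      (isClosed_discrete _).preimage hcont
    have hsub : (absInertia L : Set (absoluteGaloisGroup L)) * (Subgroup.zpowers φ : Set (absoluteGaloisGroup L)) ⊆
        {σ : absoluteGaloisGroup L | absGaloisRestrict K L σ • y - y ∈ (g.range : Set (geomTorsion E n))} := by
      rintro _ ⟨i, hi, c, hc, rfl⟩
      obtain ⟨j, rfl⟩ := Subgroup.mem_zpowers_iff.mp hc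
      change absGaloisRestrict K L (i * φ ^ j) • y - y ∈ (g.range : Set (geomTorsion E n))
      rw [map_mul, mul_smul, hI i hi, map_zpow]
      exact hzpow y j
    have hdense := dense_absInertia_mul_zpowers_of_isFrobPow L hφ
    have hτ : τ ∈ {σ : absoluteGaloisGroup L | absGaloisRestrict K L σ • y - y ∈ (g.range : Set (geomTorsion E n))} := by
      have h := (hclosed.closure_subset_iff).mpr hsub
      rw [hdense.closure_eq] at h
      exact h (Set.mem_univ τ)
    exact hτ
  · rintro m ⟨x, rfl⟩
    exact AddSubgroup.subset_closure ⟨φ, x, hgapply x⟩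

/-- **LOCAL (Trans): `𝓛_v^{Kummer}(E[p^k]) ∩ H¹_toric(K_v, E[p^k]) = 0` at every good place `v ∤ p`, witness-free.**
For an elliptic curve `E/K` over a number field and a finite place `v` of good reduction with `v ∤ p`, a class of
`H¹(K_v, E[p^k])` satisfying BOTH the local Kummer condition (= unramified, `KummerPT.kummerSelmerStructure_inr_eq_unramifiedSubgroup`)
AND the toric condition (`toricLocalCondition`: a representative valued in the augmentation subgroup) is ZERO. Proof: the toric
representative `ψ` vanishes on `I_{K_v}` (inertia acts trivially on `E[p^k]`, `LocBridge.mem_unramifiedSubgroup_one_iff_forall_eq_zero`),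
`ψ(φ) ∈ ⟨res σ · y − y⟩ = (φ − 1)E[p^k]` (§1) for a Frobenius lift `φ`, hence `[ψ] = 0`
(`oneCocycleClass_eq_zero_iff_of_vanishing_absInertia`: `H¹_ur(K_v, T) ≅ T^{I}/(φ − 1)T^{I}`). Bertolini–Darmon Lemma 2.6, the
half `H¹_fin ∩ H¹_ord = 0`, for LOCAL classes (the tree's `ToricFrob.selmerLocalKer_inf_toricLocalKer_le_torsionLocalKer` is the
statement for localisations of global classes). [cite: BertoliniDarmon2005, §2.2 Lemma 2.6] [cite: SerreLocalFields1979, XIII §1 Prop. 1]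
[cite: MilneADT2006, Ch. I Prop. 3.8] -/
theorem kummerSelmerStructure_inf_toricLocalCondition_eq_bot (p k : ℕ) [Fact p.Prime] (hpv : (p : 𝓞 K) ∉ v.asIdeal)
    (hv : E.HasGoodReductionAt v) :
    E.kummerSelmerStructure ((p ^ k : ℕ) : ℤ) (Sum.inr v) ⊓
      toricLocalCondition E (v.adicCompletion K) ((p ^ k : ℕ) : ℤ) = ⊥ := by
  set L := v.adicCompletion K with hL
  set 𝕄 := GaloisRep.restrictField L (E.torsionGaloisModule ((p ^ k : ℕ) : ℤ)) with h𝕄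
  rw [eq_bot_iff]
  intro a ha
  obtain ⟨haF, haO⟩ := AddSubgroup.mem_inf.mp ha
  rw [AddSubgroup.mem_bot]
  -- a toric representative
  obtain ⟨ψ, hψA, rfl⟩ := mem_toricLocalCondition_iff.mp haO
  -- the inertia group acts trivially; Kummer = unramified; so `ψ` vanishes on `I_{K_v}`
  have hI : ∀ τ ∈ absInertia L, ∀ y : geomTorsion E ((p ^ k : ℕ) : ℤ), 𝕄 τ y = y := fun τ hτ y ↦
    AcSelmer.restrictField_torsionGaloisModule_apply_of_mem_absInertia E p k hpv hv hτ y
  rw [KummerPT.kummerSelmerStructure_inr_eq_unramifiedSubgroup E p k hpv hv] at haF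
  have hψI : ∀ τ ∈ absInertia L, ψ.1 τ = 0 :=
    (LocBridge.mem_unramifiedSubgroup_one_iff_forall_eq_zero 𝕄 hI ψ).mp haF
  -- a Frobenius lift and `ψ(φ) ∈ (φ − 1)E[p^k]`
  obtain ⟨φ, hφ⟩ := exists_isAbsArithFrob_holds L
  have hφ1 : IsFrobPow φ 1 := IsAbsArithFrob.isFrobPow_holds hφ
  have hmem := hψA φ
  rw [closure_restrictField_eq_range E hφ1 (fun τ hτ y ↦ hI τ hτ y)] at hmem
  obtain ⟨m, hm⟩ := hmem
  -- `[ψ] = 0`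
  refine (oneCocycleClass_eq_zero_iff_of_vanishing_absInertia L (DiscreteGaloisModule.toTopRep 𝕄) 𝕄.continuous_smul
    hφ1 ψ (fun τ ↦ hψI τ τ.2)).mpr ⟨m, fun τ ↦ hI τ τ.2 m, ?_⟩
  rw [← hm]
  rfl

end ToricFrob

/-! ## §2 At a Bertolini–Darmon admissible place: `F ∩ O = 0`, `F ≠ O`, the hyperbolic dichotomy without witness -/

variable (W : WeierstrassCurve ℚ) (K : Type) [Field K] [NumberField K] (p : ℕ) [W.IsElliptic] [W.IsGloballyMinimal]
  [Fact p.Prime]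

/-- **`F_w ∩ O_w = 0` at the place `w` above a BD-admissible prime**: E's Kummer condition and the toric condition of
`H¹(K_w, E[p])` meet trivially (`q ∤ pN` gives good reduction at `w` and `w ∤ p`, `hasGoodReductionAt_of_isAdmissiblePrime`;
then §1). [cite: BertoliniDarmon2005, Lemma 2.6] -/
theorem kummerSelmerStructure_inf_toricLocalCondition_eq_bot_of_admQ (q : AdmQ W K p) (w : HeightOneSpectrum (𝓞 K))
    (hqw : ((q : ℕ) : 𝓞 K) ∈ w.asIdeal) :
    (W.baseChange K).kummerSelmerStructure ((p ^ 1 : ℕ) : ℤ) (Sum.inr w) ⊓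
      toricLocalCondition (W.baseChange K) (w.adicCompletion K) ((p ^ 1 : ℕ) : ℤ) = ⊥ := by
  obtain ⟨hgood, hpv⟩ := hasGoodReductionAt_of_isAdmissiblePrime W K q.2 w hqw
  rw [Int.cast_natCast] at hpv
  exact ToricFrob.kummerSelmerStructure_inf_toricLocalCondition_eq_bot (W.baseChange K) p 1 hpv hgood

/-- **`F_w ≠ O_w` at the place `w` above a BD-admissible prime, witness-free** (`K` imaginary quadratic): the Kummer line
(`#F_w = p`, `natCard_kummer_eq_of_admQ`) meets the toric line trivially, so the two lines of the hyperbolic plane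
`H¹(K_w, E[p])` are distinct — the statement for which p572961 and (R) p577255 consumed a global Kummer class not locally
trivial at `w`. [cite: BertoliniDarmon2005, Lemma 2.6 (H¹_fin ∩ H¹_ord = 0, dim = 1 each)] -/
theorem kummerSelmerStructure_ne_toricLocalCondition_of_admQ (hK : IsImaginaryQuadratic K) (q : AdmQ W K p)
    (w : HeightOneSpectrum (𝓞 K)) (hqw : ((q : ℕ) : 𝓞 K) ∈ w.asIdeal) :
    (W.baseChange K).kummerSelmerStructure ((p ^ 1 : ℕ) : ℤ) (Sum.inr w) ≠
      toricLocalCondition (W.baseChange K) (w.adicCompletion K) ((p ^ 1 : ℕ) : ℤ) := by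
  intro hFO
  have hp : p.Prime := Fact.out
  have hinf := kummerSelmerStructure_inf_toricLocalCondition_eq_bot_of_admQ W K p q w hqw
  rw [← hFO, inf_idem] at hinf
  have hcard := natCard_kummer_eq_of_admQ W K p hK q w hqw
  rw [hinf, AddSubgroup.card_bot] at hcard
  exact hp.one_lt.ne hcard

/-- **An ISOTROPIC class at an admissible place is KUMMER or TORIC there — WITNESS-FREE.** `K` imaginary quadratic;
`q` a Bertolini–Darmon admissible prime with place `w ∋ q`; a Weil pairing `e` on `E[p]` and a Poitou–Tate family `inv` with
`IsPerfect`. Then every global class `g` whose localisation is isotropic, `inv_w(loc g ∪ₑ loc g) = 0`, satisfies E's Kummer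
condition at `w` or the toric condition at `w`. This is akr-p2x g0's `mem_selmerLocalKer_or_mem_toricLocalKer_of_isotropic`
(p572961) with its global witness `x` (Kummer at `w`, not locally trivial at `w`) REMOVED: the one use of `x`, `F ≠ O`, is now
`kummerSelmerStructure_ne_toricLocalCondition_of_admQ` (local (Trans), §1). Rest of the proof verbatim: `H¹(K_w, E[p]) = F ⊕ O`
(orders `p², p, p`; `F = F^⊥`, `O = O^⊥`), `loc g = f + o`, `0 = b(f+o, f+o) = 2 b(f, o)` by isotropy and SYMMETRY, `p` odd;
if `f ≠ 0` it generates `F`, so `o ∈ F^⊥ ∩ O = 0`. [cite: BertoliniDarmon2005, Lemma 2.6] [cite: WZhang2014, Lemma 5.1]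
[cite: MilneADT2006, Ch. I, Cor. 2.3, Thm. 2.8] -/
theorem mem_selmerLocalKer_or_mem_toricLocalKer_of_isotropic_free
    -- cup products need the compactness of the local absolute Galois groups (binder, discharged by
    -- `absoluteGaloisGroup_compactSpace` at the call site)
    [∀ v : Place K, CompactSpace (absoluteGaloisGroup (Place.Completion v))]
    (hK : IsImaginaryQuadratic K) (hp2 : p ≠ 2)
    (q : AdmQ W K p) (w : HeightOneSpectrum (𝓞 K)) (hqw : ((q : ℕ) : 𝓞 K) ∈ w.asIdeal)
    (e : geomTorsion (W.baseChange K) ((p ^ 1 : ℕ) : ℤ) → geomTorsion (W.baseChange K) ((p ^ 1 : ℕ) : ℤ) →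
      AlgebraicClosure K)
    (hμ : ∀ P Q, e P Q ^ (p ^ 1) = 1) (hadd₁ : ∀ P₁ P₂ Q, e (P₁ + P₂) Q = e P₁ Q * e P₂ Q)
    (hadd₂ : ∀ P Q₁ Q₂, e P (Q₁ + Q₂) = e P Q₁ * e P Q₂) (halt : ∀ Q, e Q Q = 1)
    (hnondeg : ∀ Q, (∀ P, e P Q = 1) → Q = 0)
    (hgal : ∀ (σ : absoluteGaloisGroup K) (P Q : geomTorsion (W.baseChange K) ((p ^ 1 : ℕ) : ℤ)),
      σ • e P Q = e (σ • P) (σ • Q))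
    (inv : LocalInvariants K (p ^ 1)) (hperf : inv.IsPerfect)
    {g : Vp W K p}
    (hg : invWeilPairing (W.baseChange K) (p ^ 1) e hμ hadd₁ hadd₂ hgal inv (Sum.inr w)
      (galoisCohomology.localization ((W.baseChange K).torsionGaloisModule ((p ^ 1 : ℕ) : ℤ)) (Sum.inr w) 1 g)
      (galoisCohomology.localization ((W.baseChange K).torsionGaloisModule ((p ^ 1 : ℕ) : ℤ)) (Sum.inr w) 1 g)
        = 0) :
    g ∈ selmerLocalKer (W.baseChange K) (w.adicCompletion K) ((p ^ 1 : ℕ) : ℤ) ∨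
      g ∈ toricLocalKer (W.baseChange K) (w.adicCompletion K) ((p ^ 1 : ℕ) : ℤ) := by
  have hp : p.Prime := Fact.out
  haveI : NeZero (p ^ 1 : ℕ) := ⟨pow_ne_zero 1 hp.ne_zero⟩
  haveI : IsTotallyComplex K := hK.2
  have hK2 : Module.finrank ℚ K = 2 := hK.1
  have hKc : ∀ u : InfinitePlace K, u.IsComplex := fun u ↦ IsTotallyComplex.isComplex u
  have hp1 : IsPrimePow (p ^ 1 : ℕ) := hp.isPrimePow.pow one_ne_zero
  have hEP : ∀ v : HeightOneSpectrum (𝓞 K), localEulerPoincareCharacteristic (v.adicCompletion K) := fun v ↦ by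
    haveI : CharZero (v.adicCompletion K) := charZero_of_injective_algebraMap (algebraMap K _).injective
    exact localEulerPoincareCharacteristic_holds (v.adicCompletion K)
  have hinj : Injective (inv (Sum.inr w)) := (hperf w).1.1
  -- the plane, its pairing, the two lines
  set H := galoisCohomology (((W.baseChange K).torsionGaloisModule ((p ^ 1 : ℕ) : ℤ)).toLocal (Sum.inr w)) 1 with hH
  set loc := galoisCohomology.localization ((W.baseChange K).torsionGaloisModule ((p ^ 1 : ℕ) : ℤ)) (Sum.inr w) 1
    with hloc
  set b := invWeilPairing (W.baseChange K) (p ^ 1) e hμ hadd₁ hadd₂ hgal inv (Sum.inr w) with hb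
  set F : AddSubgroup H := (W.baseChange K).kummerSelmerStructure ((p ^ 1 : ℕ) : ℤ) (Sum.inr w) with hF
  set O : AddSubgroup H := toricLocalCondition (W.baseChange K) (w.adicCompletion K) ((p ^ 1 : ℕ) : ℤ) with hO
  haveI : Finite H := KummerPT.finite_galoisCohomology_toLocal_inr (W.baseChange K) (p ^ 1) w
  have hA : ∀ y : H, (p ^ 1 : ℕ) • y = 0 := KummerPT.nsmul_galoisCohomology_toLocal_eq_zero (W.baseChange K) (p ^ 1)
    (Sum.inr w)
  have hflip : Bijective b.flip :=
    KummerPT.invWeilPairing_flip_bijective (W.baseChange K) (p ^ 1) e hμ hadd₁ hadd₂ hgal hnondeg inv w hinj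
  -- symmetry and isotropies
  have hsymm : ∀ a a' : H, b a a' = b a' a := fun a a' ↦
    invWeilPairing_comm W K p e hμ hadd₁ hadd₂ halt hgal inv (Sum.inr w) a a'
  have hisoF : ∀ a ∈ F, ∀ a' ∈ F, b a a' = 0 := fun a ha a' ha' ↦
    invWeilPairing_eq_zero_of_mem (W.baseChange K) (p ^ 1) e hμ hadd₁ hadd₂ hgal halt inv (Sum.inr w) ha ha'
  have hisoO : ∀ a ∈ O, ∀ a' ∈ O, b a a' = 0 := fun a ha a' ha' ↦ by
    rw [hb, invWeilPairing_apply, htorIso_toricLocalCondition W K p hK2 q w hqw e hμ hadd₁ hadd₂ halt hgal a ha a' ha']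
    exact map_zero _
  -- both lines are Lagrangian
  have hFann : annRight b F = F :=
    KummerDuality.annRight_invWeilPairing_kummerSelmerStructure_eq (W.baseChange K) (p ^ 1) e hμ hadd₁ hadd₂ hgal
      halt hnondeg inv hKc hp1 hperf hEP (Sum.inr w)
  have hOann : annRight b O = O :=
    annRight_invWeilPairing_eq_of_isotropic_of_card_le (W.baseChange K) (p ^ 1) e hμ hadd₁ hadd₂ hgal hnondeg inv w
      hinj O (fun a ha a' ha' ↦ htorIso_toricLocalCondition W K p hK2 q w hqw e hμ hadd₁ hadd₂ halt hgal a ha a' ha')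
      (natCard_galoisCohomology_one_le_mul_natCard_toricLocalCondition W K p hK2 q w hqw)
  -- counts: `#H = p²`, `#F = #O = p`
  have hHcard : Nat.card H = p ^ 2 := by
    obtain ⟨-, hpv⟩ := hasGoodReductionAt_of_isAdmissiblePrime W K q.2 w hqw
    have hle := natCard_invariants_le_of_admQ W K p hK2 q w hqw
    have hge := le_natCard_invariants_of_admQ W K p hK2 q w hqw
    rw [hH, Nat.pow_one]
    rw [Nat.pow_one] at hle hge
    rw [Int.cast_natCast] at hpv
    rw [natCard_galoisCohomology_one_torsion_eq_sq (W.baseChange K) p w hpv]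
    have heq : Nat.card (GaloisRep.restrictField (w.adicCompletion K)
        ((W.baseChange K).torsionGaloisModule (p : ℤ))).toTopRep.ρ.invariants = p := le_antisymm hle hge
    rw [heq]
  have hFcard : Nat.card F = p := by
    have h := natCard_annRight_mul hA b hflip F
    rw [hFann, hHcard, sq] at h
    exact Nat.mul_self_inj.mp h
  have hOcard : Nat.card O = p := by
    have h := natCard_annRight_mul hA b hflip O
    rw [hOann, hHcard, sq] at h
    exact Nat.mul_self_inj.mp h
  -- the two lines are distinct: local (Trans), §1 (no global witness)
  have hFO : F ≠ O := kummerSelmerStructure_ne_toricLocalCondition_of_admQ W K p hK q w hqw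
  -- `F ∩ O = 0` and `F + O = H`
  have hinf : F ⊓ O = ⊥ := by
    have hle : F ⊓ O ≤ F := inf_le_left
    have hdvd : Nat.card (F ⊓ O : AddSubgroup H) ∣ p := by
      have h := AddSubgroup.card_dvd_of_le hle
      rwa [hFcard] at h
    rcases (Nat.dvd_prime hp).mp hdvd with h1 | hpc
    · exact AddSubgroup.eq_bot_of_card_eq (F ⊓ O) h1
    · exfalso
      have hFle : F ≤ O := by
        have heq : F ⊓ O = F := AddSubgroup.eq_of_le_of_card_ge hle (by rw [hFcard, hpc])
        rw [← heq]
        exact inf_le_right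
      exact hFO (AddSubgroup.eq_of_le_of_card_ge hFle (by rw [hFcard, hOcard]))
  have hsup : F ⊔ O = ⊤ := by
    have hle : F ≤ F ⊔ O := le_sup_left
    have hdvdH : Nat.card (F ⊔ O : AddSubgroup H) ∣ p ^ 2 := by
      have h := AddSubgroup.card_addSubgroup_dvd_card (F ⊔ O)
      rwa [hHcard] at h
    have hdvdF : p ∣ Nat.card (F ⊔ O : AddSubgroup H) := by
      have h := AddSubgroup.card_dvd_of_le hle
      rwa [hFcard] at h
    obtain ⟨i, hi, hci⟩ := (Nat.dvd_prime_pow hp).mp hdvdH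
    have hne : Nat.card (F ⊔ O : AddSubgroup H) ≠ p := by
      intro hc
      have heq : F = F ⊔ O := AddSubgroup.eq_of_le_of_card_ge hle (by rw [hFcard, hc])
      have hOle : O ≤ F := by
        rw [heq]
        exact le_sup_right
      exact hFO (AddSubgroup.eq_of_le_of_card_ge hOle (by rw [hFcard, hOcard])).symm
    interval_cases i
    · exfalso
      rw [pow_zero] at hci
      rw [hci] at hdvdF
      exact hp.one_lt.ne' (Nat.dvd_one.mp hdvdF)
    · exact absurd (by rw [hci, pow_one]) hne
    · exact AddSubgroup.eq_top_of_card_eq _ (by rw [hci, hHcard])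
  -- decompose `loc g = f + o` and pair
  obtain ⟨f, hf, o, ho, hfo⟩ := AddSubgroup.mem_sup.mp (show loc g ∈ F ⊔ O by rw [hsup]; exact AddSubgroup.mem_top _)
  have h2 : (2 : ZMod (p ^ 1)) * b f o = 0 := by
    have h := hg
    rw [← hfo] at h
    simp only [map_add, AddMonoidHom.add_apply, hisoF f hf f hf, hisoO o ho o ho, hsymm o f, zero_add,
      add_zero] at h
    rw [two_mul]
    exact h
  have hu : IsUnit (2 : ZMod (p ^ 1)) := by
    rw [pow_one, show (2 : ZMod p) = ((2 : ℕ) : ZMod p) by norm_cast, ZMod.isUnit_iff_coprime]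
    exact (Nat.coprime_primes Nat.prime_two hp).mpr (Ne.symm hp2)
  have hbfo : b f o = 0 := (hu.mul_right_eq_zero).mp h2
  by_cases hf0 : f = 0
  · -- `loc g = o` is toric
    right
    refine mem_toricLocalKer_of_res_mem_toricLocalCondition (W.baseChange K) (p ^ 1) (w.adicCompletion K) ?_
    change loc g ∈ O
    rw [← hfo, hf0, zero_add]
    exact ho
  · -- `f` generates `F`, so `o ∈ F^⊥ = F`, `o ∈ F ∩ O = 0`, `loc g = f` is Kummer
    left
    have hgen : AddSubgroup.zmultiples f = F := zmultiples_eq_of_card_prime F hp hFcard hf hf0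
    have hoF : o ∈ F := by
      rw [← hFann, mem_annRight_iff]
      intro f' hf'
      rw [← hgen, AddSubgroup.mem_zmultiples_iff] at hf'
      obtain ⟨k, rfl⟩ := hf'
      rw [map_zsmul, AddMonoidHom.zsmul_apply, hbfo, smul_zero]
    have ho0 : o = 0 := by
      have : o ∈ F ⊓ O := AddSubgroup.mem_inf.mpr ⟨hoF, ho⟩
      rw [hinf] at this
      exact (AddSubgroup.mem_bot).mp this
    have hgF : loc g ∈ F := by
      rw [← hfo, ho0, add_zero]
      exact hf
    rw [hF, WeierstrassCurve.kummerSelmerStructure_apply] at hgF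
    exact (mem_selmerLocalKer_iff_localization_mem_kummer_P W K p w g).mpr hgF

end Summit.BirchSwinnertonDyer.BirchSwinnertonDyer.Theorems.AdditiveKoly


end
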